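import Summits.BirchSwinnertonDyer.BirchSwinnertonDyer.Theorems.ManinLocalTwoThreeManinPrimeToAdditiveFiveLeRedFiveSevenCells
import Summits.BirchSwinnertonDyer.BirchSwinnertonDyer.Theorems.ManinLocalTwoThreeManinPrimeToAdditiveFiveLeRedSevenTypeIITwinAnchor
import HarnessLib

/-!
# Route `ManinLocalTwoThree`, residual crux C5 `ManinPrimeToAdditiveFiveLe`
# (stmt-BirchSwinnertonDyer-22969), line `upper_anchor` (skeleton v9):
# **the finest cell table — after the twin rescue of `(7; II)` the ONLY Raynaud-void cell is `(5; III)`**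

Lead seat bsd-line-ml23-c5-p1 (gen 5). Composition of two landed reductions of the v8 anchor stub
`stub_red57unstarredOffIIAtFive` (Manin for unstarred `W[p]`-reducible lattice-optimal curves at `p ∈ {5, 7}` off `(5; II)`):

* gen 5 (`…RedFiveSevenCells`, p625709): anchor ⟸ SS57 `(5;IV) ∪ (7;III)` ∧ ORD7 `(7;IV)` ∧ CORNER57 `(5;III) ∪ (7;II)` — the
  Ogg–Tate case split on `(p; ord_p Δ_min)`;
* gen 4 (ν, `…RedSevenTypeIITwinAnchor`, p624458): anchor ⟸ anchor[off `(5;II)`, `(7;II)`] ∧ ANCHOR(7; IV*) ∧ DEGREE-UP(7; II) — the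
  Kodaira-II cell at `7` (tame index `e = 6 = p − 1`, Raynaud-void, potentially ORDINARY, commuting orbit II → IV* 112/112 in range)
  rides its STARRED twin IV* (`e = 3 < 6`, inside Raynaud's range) modulo the `(7; II)` instance of the degree law (optimal-orbit
  trichotomy + near-invariance, both PROVED by the an-cell).

THIS FILE: `coreRED57unstarredOffII5_of_cells_of_anchorIVstarSeven_of_degreeUpIISeven` —
**anchor (v8, VERBATIM) ⟸ SS57 ∧ ORD7 ∧ CORNER(5; III) ∧ ANCHOR(7; IV*) ∧ DEGREE-UP(7; II)**, i.e. in the cell table of C5's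
`W[p]`-reducible residue at `p ∈ {5, 7}` the cells with Raynaud's hypothesis `e < p − 1` AVAILABLE are SS57 (`e = 3, 4`, pot-ss),
ORD7 (`e = 3`, pot-ord, unstarred) and ANCHOR(7; IV*) (`e = 3`, pot-ord, STARRED — the `p = 7` analogue of the Kodaira half of
Edixhoven's printed Thm. 3, tree fact `edixhoven_not_dvd_maninConstant_of_kodairaSymbol_ne` at `p > 7`), and the ONE cell where
`e = p − 1` with no twin rescue is the Kosters–Pannekoek corner `(5; III)` (`e = 4`; its commuting twin III* also has `e = 4`).
The laws are DEGREE-UP(7; II) (Edixhoven case 1 excluded on the II → IV* orbit; 112/112 in range) and, elsewhere in the skeleton,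
(U) and DegreeUp13Red.

| cell | e | Raynaud `e < p − 1` | ordinarity | carried by |
|---|---|---|---|---|
| (5; II) | 6 | no | ss | flip twin (5; IV) + CORNER(5;II) ⟸ (U) (p622240, p623176) |
| (5; IV), (7; III) = SS57 | 3, 4 | YES | ss | OPEN — printed mechanism (Edixhoven Props 5–8 + parity) |
| (7; IV) = ORD7 | 3 | YES | ord | OPEN — Edixhoven case 1 |
| (7; II) | 6 | no | ord | starred twin (7; IV*) + DEGREE-UP(7; II) (ν p624458, folded HERE) |
| (7; IV*) = ANCHOR7IV* | 3 | YES | ord, starred | OPEN — `p = 7` analogue of Edixhoven's Kodaira half |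
| (5; III) = CORNER5III | 4 | no | ord | OPEN — no method in print or tree |

HONEST STATUS. Conditional result (`--supports`, helper) between OPEN statements. Not a reshape (skeleton v9 keeps CORNER57 whole:
stubs_max = 7). Nothing here proves any cell, C5, Manin's conjecture or BSD. No summit statement is proved by this seat.

References: [EdixhovenManin1991] Thm. 3, Props. 7–9, §4; [SilvermanATAEC1994] IV Table 4.1; [KostersPannekoek2017] Thm. 1;
[ZagierCMB1985] §1.
-/

set_option autoImplicit false
-- the Theorems namespace of this sub repeats the summit name by design (D-0017 nested layout)
set_option linter.dupNamespace false

noncomputable section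

open scoped Classical NumberField

namespace Summit.BirchSwinnertonDyer.BirchSwinnertonDyer.Theorems

open WeierstrassCurve IsDedekindDomain IsDedekindDomain.HeightOneSpectrum Rat.HeightOneSpectrum NumberField
  Literature.NumberTheory.EllipticCurves Literature.NumberTheory.EllipticCurves.ModularForms
  Literature.NumberTheory.EllipticCurves.Rank1Residual
  Literature.NumberTheory.DiophantineGeometry
  Summit.BirchSwinnertonDyer.Rank1Residual.ManinAdditive
  Summit.BirchSwinnertonDyer.Rank1Residual.Additive

/-- **v8 anchor `stub_red57unstarredOffIIAtFive` (VERBATIM as the conclusion) ⟸ SS57 (`hSS`) ∧ ORD7 (`hORD`) ∧ CORNER(5; III)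
(`hC5III`: the anchor restricted to `p = 5`, `ord₅ Δ_min = 3`) ∧ ANCHOR(7; IV*) (`hS`: RED(57♯) binders for `W` of type IV* at 7,
hypothesis `hS` of ν verbatim) ∧ DEGREE-UP(7; II) (`hUp`, hypothesis of ν verbatim).** Proof: ν (p624458) reduces the anchor to
the anchor off both Kodaira-II cells plus `hS`, `hUp`; off `(5;II)` and `(7;II)` the Ogg–Tate case split
(`kodairaSymbolAt_placeOf_cases_of_addv`) leaves exactly `(5;3)` → `hC5III`, `(5;4), (7;3)` → `hSS`, `(7;4)` → `hORD`.
Conditional result between OPEN statements; nothing here proves C5. [cite: EdixhovenManin1991, Thm. 3 and §4]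
[cite: SilvermanATAEC1994, IV Table 4.1] -/
theorem coreRED57unstarredOffII5_of_cells_of_anchorIVstarSeven_of_degreeUpIISeven
    (hSS : mazur_not_dvd_maninConstant_of_odd → abbesUllmo_not_dvd_maninConstant_of_not_dvd_level →
      cesnavicius_not_two_dvd_maninConstant_of_two_dvd_level → exists_isNewformOf →
      ∀ (W : WeierstrassCurve ℚ) [W.IsElliptic] [W.IsGloballyMinimal] [NeZero (W.conductorNorm ℤ)]
        (D : ModularParametrizationData W (W.conductorNorm ℤ)),
        IsLatticeOptimal D → ∀ (p : ℕ) (hp : p.Prime), (p = 5 ∨ p = 7) → p ^ 2 ∣ W.conductorNorm ℤ →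
        ¬ (∃ (W' : WeierstrassCurve ℚ) (q : ℕ), W'.IsElliptic ∧ W'.IsGloballyMinimal ∧ q.Prime ∧
            q ≠ 2 ∧ q ^ 2 ∣ W.conductorNorm ℤ ∧
            IsIsogenous W (W'.quadraticTwist (((-1 : ℤ) ^ (q / 2) * q : ℤ) : ℚ)) ∧
            ¬ q ^ 2 ∣ W'.conductorNorm ℤ) →
        ¬ (∃ (W' : WeierstrassCurve ℚ) (d : ℤ), W'.IsElliptic ∧ W'.IsGloballyMinimal ∧
            (d = -1 ∨ d = 2 ∨ d = -2) ∧ 2 ^ 2 ∣ W.conductorNorm ℤ ∧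
            IsIsogenous W (W'.quadraticTwist (d : ℚ)) ∧ ¬ 2 ^ 2 ∣ W'.conductorNorm ℤ) →
        ¬ W.HasIrreducibleModPGaloisRep p →
        500000 < W.conductorNorm ℤ →
        p ∣ D.modularDegree →
        (∀ n : ℕ, W.kodairaSymbolAt ((Rat.HeightOneSpectrum.primesEquiv (R := ℤ)).symm ⟨p, hp⟩) ≠
          .Istar n) →
        padicValInt p W.minimalDiscriminantInt ≤ 4 →
        (p = 5 → padicValInt p W.minimalDiscriminantInt ≠ 2) →
        ((p = 5 ∧ padicValInt p W.minimalDiscriminantInt = 4) ∨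
          (p = 7 ∧ padicValInt p W.minimalDiscriminantInt = 3)) →
        ¬ (p : ℤ) ∣ D.maninConstant)
    (hORD : mazur_not_dvd_maninConstant_of_odd → abbesUllmo_not_dvd_maninConstant_of_not_dvd_level →
      cesnavicius_not_two_dvd_maninConstant_of_two_dvd_level → exists_isNewformOf →
      ∀ (W : WeierstrassCurve ℚ) [W.IsElliptic] [W.IsGloballyMinimal] [NeZero (W.conductorNorm ℤ)]
        (D : ModularParametrizationData W (W.conductorNorm ℤ)),
        IsLatticeOptimal D → ∀ (p : ℕ) (hp : p.Prime), (p = 5 ∨ p = 7) → p ^ 2 ∣ W.conductorNorm ℤ →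
        ¬ (∃ (W' : WeierstrassCurve ℚ) (q : ℕ), W'.IsElliptic ∧ W'.IsGloballyMinimal ∧ q.Prime ∧
            q ≠ 2 ∧ q ^ 2 ∣ W.conductorNorm ℤ ∧
            IsIsogenous W (W'.quadraticTwist (((-1 : ℤ) ^ (q / 2) * q : ℤ) : ℚ)) ∧
            ¬ q ^ 2 ∣ W'.conductorNorm ℤ) →
        ¬ (∃ (W' : WeierstrassCurve ℚ) (d : ℤ), W'.IsElliptic ∧ W'.IsGloballyMinimal ∧
            (d = -1 ∨ d = 2 ∨ d = -2) ∧ 2 ^ 2 ∣ W.conductorNorm ℤ ∧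
            IsIsogenous W (W'.quadraticTwist (d : ℚ)) ∧ ¬ 2 ^ 2 ∣ W'.conductorNorm ℤ) →
        ¬ W.HasIrreducibleModPGaloisRep p →
        500000 < W.conductorNorm ℤ →
        p ∣ D.modularDegree →
        (∀ n : ℕ, W.kodairaSymbolAt ((Rat.HeightOneSpectrum.primesEquiv (R := ℤ)).symm ⟨p, hp⟩) ≠
          .Istar n) →
        padicValInt p W.minimalDiscriminantInt ≤ 4 →
        (p = 5 → padicValInt p W.minimalDiscriminantInt ≠ 2) →
        p = 7 → padicValInt p W.minimalDiscriminantInt = 4 →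
        ¬ (p : ℤ) ∣ D.maninConstant)
    (hC5III : mazur_not_dvd_maninConstant_of_odd → abbesUllmo_not_dvd_maninConstant_of_not_dvd_level →
      cesnavicius_not_two_dvd_maninConstant_of_two_dvd_level → exists_isNewformOf →
      ∀ (W : WeierstrassCurve ℚ) [W.IsElliptic] [W.IsGloballyMinimal] [NeZero (W.conductorNorm ℤ)]
        (D : ModularParametrizationData W (W.conductorNorm ℤ)),
        IsLatticeOptimal D → ∀ (p : ℕ) (hp : p.Prime), (p = 5 ∨ p = 7) → p ^ 2 ∣ W.conductorNorm ℤ →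
        ¬ (∃ (W' : WeierstrassCurve ℚ) (q : ℕ), W'.IsElliptic ∧ W'.IsGloballyMinimal ∧ q.Prime ∧
            q ≠ 2 ∧ q ^ 2 ∣ W.conductorNorm ℤ ∧
            IsIsogenous W (W'.quadraticTwist (((-1 : ℤ) ^ (q / 2) * q : ℤ) : ℚ)) ∧
            ¬ q ^ 2 ∣ W'.conductorNorm ℤ) →
        ¬ (∃ (W' : WeierstrassCurve ℚ) (d : ℤ), W'.IsElliptic ∧ W'.IsGloballyMinimal ∧
            (d = -1 ∨ d = 2 ∨ d = -2) ∧ 2 ^ 2 ∣ W.conductorNorm ℤ ∧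
            IsIsogenous W (W'.quadraticTwist (d : ℚ)) ∧ ¬ 2 ^ 2 ∣ W'.conductorNorm ℤ) →
        ¬ W.HasIrreducibleModPGaloisRep p →
        500000 < W.conductorNorm ℤ →
        p ∣ D.modularDegree →
        (∀ n : ℕ, W.kodairaSymbolAt ((Rat.HeightOneSpectrum.primesEquiv (R := ℤ)).symm ⟨p, hp⟩) ≠
          .Istar n) →
        padicValInt p W.minimalDiscriminantInt ≤ 4 →
        (p = 5 → padicValInt p W.minimalDiscriminantInt ≠ 2) →
        p = 5 → padicValInt p W.minimalDiscriminantInt = 3 →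
        ¬ (p : ℤ) ∣ D.maninConstant)
    (hS : mazur_not_dvd_maninConstant_of_odd → abbesUllmo_not_dvd_maninConstant_of_not_dvd_level →
      cesnavicius_not_two_dvd_maninConstant_of_two_dvd_level → exists_isNewformOf →
      ∀ (W : WeierstrassCurve ℚ) [W.IsElliptic] [W.IsGloballyMinimal] [NeZero (W.conductorNorm ℤ)]
        (D : ModularParametrizationData W (W.conductorNorm ℤ)),
        IsLatticeOptimal D → ∀ (p : ℕ) (hp : p.Prime), (p = 5 ∨ p = 7) → p ^ 2 ∣ W.conductorNorm ℤ →
        ¬ (∃ (W' : WeierstrassCurve ℚ) (q : ℕ), W'.IsElliptic ∧ W'.IsGloballyMinimal ∧ q.Prime ∧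
            q ≠ 2 ∧ q ^ 2 ∣ W.conductorNorm ℤ ∧
            IsIsogenous W (W'.quadraticTwist (((-1 : ℤ) ^ (q / 2) * q : ℤ) : ℚ)) ∧
            ¬ q ^ 2 ∣ W'.conductorNorm ℤ) →
        ¬ (∃ (W' : WeierstrassCurve ℚ) (d : ℤ), W'.IsElliptic ∧ W'.IsGloballyMinimal ∧
            (d = -1 ∨ d = 2 ∨ d = -2) ∧ 2 ^ 2 ∣ W.conductorNorm ℤ ∧
            IsIsogenous W (W'.quadraticTwist (d : ℚ)) ∧ ¬ 2 ^ 2 ∣ W'.conductorNorm ℤ) →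
        ¬ W.HasIrreducibleModPGaloisRep p →
        500000 < W.conductorNorm ℤ →
        p ∣ D.modularDegree →
        (∀ n : ℕ, W.kodairaSymbolAt ((Rat.HeightOneSpectrum.primesEquiv (R := ℤ)).symm ⟨p, hp⟩) ≠
          .Istar n) →
        p = 7 → padicValInt p W.minimalDiscriminantInt = 8 →
        ¬ (p : ℤ) ∣ D.maninConstant)
    (hUp : exists_isNewformOf →
      ∀ (W : WeierstrassCurve ℚ) [W.IsElliptic] [W.IsGloballyMinimal] [NeZero (W.conductorNorm ℤ)]
        (D : ModularParametrizationData W (W.conductorNorm ℤ)),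
        IsLatticeOptimal D → ∀ (p : ℕ) (hp : p.Prime), p = 7 → p ^ 2 ∣ W.conductorNorm ℤ →
        ¬ (∃ (W' : WeierstrassCurve ℚ) (q : ℕ), W'.IsElliptic ∧ W'.IsGloballyMinimal ∧ q.Prime ∧
            q ≠ 2 ∧ q ^ 2 ∣ W.conductorNorm ℤ ∧
            IsIsogenous W (W'.quadraticTwist (((-1 : ℤ) ^ (q / 2) * q : ℤ) : ℚ)) ∧
            ¬ q ^ 2 ∣ W'.conductorNorm ℤ) →
        ¬ (∃ (W' : WeierstrassCurve ℚ) (d : ℤ), W'.IsElliptic ∧ W'.IsGloballyMinimal ∧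
            (d = -1 ∨ d = 2 ∨ d = -2) ∧ 2 ^ 2 ∣ W.conductorNorm ℤ ∧
            IsIsogenous W (W'.quadraticTwist (d : ℚ)) ∧ ¬ 2 ^ 2 ∣ W'.conductorNorm ℤ) →
        ¬ W.HasIrreducibleModPGaloisRep p →
        500000 < W.conductorNorm ℤ →
        p ∣ D.modularDegree →
        (∀ n : ℕ, W.kodairaSymbolAt ((Rat.HeightOneSpectrum.primesEquiv (R := ℤ)).symm ⟨p, hp⟩) ≠
          .Istar n) →
        padicValInt p W.minimalDiscriminantInt = 2 →
        ∀ (W' : WeierstrassCurve ℚ) [W'.IsElliptic] [W'.IsGloballyMinimal] [NeZero (W'.conductorNorm ℤ)]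
          (D' : ModularParametrizationData W' (W'.conductorNorm ℤ)),
          IsLatticeOptimal D' → W'.conductorNorm ℤ = W.conductorNorm ℤ →
          IsIsogenous (W.quadraticTwist (((-1 : ℤ) ^ (p / 2) * p : ℤ) : ℚ)) W' →
          D'.modularDegree = p * D.modularDegree) :
    mazur_not_dvd_maninConstant_of_odd → abbesUllmo_not_dvd_maninConstant_of_not_dvd_level →
    cesnavicius_not_two_dvd_maninConstant_of_two_dvd_level → exists_isNewformOf →
    ∀ (W : WeierstrassCurve ℚ) [W.IsElliptic] [W.IsGloballyMinimal] [NeZero (W.conductorNorm ℤ)]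
      (D : ModularParametrizationData W (W.conductorNorm ℤ)),
      IsLatticeOptimal D → ∀ (p : ℕ) (hp : p.Prime), (p = 5 ∨ p = 7) → p ^ 2 ∣ W.conductorNorm ℤ →
      ¬ (∃ (W' : WeierstrassCurve ℚ) (q : ℕ), W'.IsElliptic ∧ W'.IsGloballyMinimal ∧ q.Prime ∧
          q ≠ 2 ∧ q ^ 2 ∣ W.conductorNorm ℤ ∧
          IsIsogenous W (W'.quadraticTwist (((-1 : ℤ) ^ (q / 2) * q : ℤ) : ℚ)) ∧
          ¬ q ^ 2 ∣ W'.conductorNorm ℤ) →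
      ¬ (∃ (W' : WeierstrassCurve ℚ) (d : ℤ), W'.IsElliptic ∧ W'.IsGloballyMinimal ∧
          (d = -1 ∨ d = 2 ∨ d = -2) ∧ 2 ^ 2 ∣ W.conductorNorm ℤ ∧
          IsIsogenous W (W'.quadraticTwist (d : ℚ)) ∧ ¬ 2 ^ 2 ∣ W'.conductorNorm ℤ) →
      ¬ W.HasIrreducibleModPGaloisRep p →
      500000 < W.conductorNorm ℤ →
      p ∣ D.modularDegree →
      (∀ n : ℕ, W.kodairaSymbolAt ((Rat.HeightOneSpectrum.primesEquiv (R := ℤ)).symm ⟨p, hp⟩) ≠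
        .Istar n) →
      padicValInt p W.minimalDiscriminantInt ≤ 4 →
      (p = 5 → padicValInt p W.minimalDiscriminantInt ≠ 2) →
      ¬ (p : ℤ) ∣ D.maninConstant := by
  refine coreRED57unstarredOffII5_of_offII57_of_anchorIVstarSeven_of_degreeUpIISeven ?_ hS hUp
  intro hM hAU hC hnf W _ _ _ D hD p hp h57 hpN hodd hdy hred hN hdeg hI hv h52 h72
  haveI hpF : Fact p.Prime := ⟨hp⟩
  have h5 : 5 ≤ p := by omega
  have hadd : Addv W p := not_good_and_not_mult_of_sq_dvd_conductorNorm W hpN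
  -- Ogg–Tate: the seven additive Kodaira rows with their `ord_p Δ_min`; both type-II cells are excluded here
  rcases kodairaSymbolAt_placeOf_cases_of_addv W p h5 hadd with
    ⟨-, h2⟩ | ⟨-, h3⟩ | ⟨-, h4⟩ | ⟨m, hm, -⟩ | ⟨-, h8⟩ | ⟨-, h9⟩ | ⟨-, h10⟩
  · rcases id h57 with h | h
    · exact absurd h2 (h52 h)
    · exact absurd h2 (h72 h)
  · rcases id h57 with h | h
    · exact hC5III hM hAU hC hnf W D hD p hp h57 hpN hodd hdy hred hN hdeg hI hv h52 h h3
    · exact hSS hM hAU hC hnf W D hD p hp h57 hpN hodd hdy hred hN hdeg hI hv h52 (Or.inr ⟨h, h3⟩)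
  · rcases id h57 with h | h
    · exact hSS hM hAU hC hnf W D hD p hp h57 hpN hodd hdy hred hN hdeg hI hv h52 (Or.inl ⟨h, h4⟩)
    · exact hORD hM hAU hC hnf W D hD p hp h57 hpN hodd hdy hred hN hdeg hI hv h52 h h4
  · exact absurd hm (hI m)
  · omega
  · omega
  · omega

end Summit.BirchSwinnertonDyer.BirchSwinnertonDyer.Theorems

end
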